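import Mathlib
import HarnessLib
import Summits.CriticalPhenomena.PercolationContinuityZ3.Theses.PercLowPointHalfSpace
import Summits.CriticalPhenomena.PercolationContinuityZ3.Theorems.PercLowPointHalfSpaceAssemblyRootAvoiding

/-!
# Route `PercLowPointHalfSpace`, item `Assembly`: the shell criterion (certified exponent bookkeeping)

Helper file for item `stmt-CriticalPhenomena-0915` (`Assembly`) of route
`CriticalPhenomena/PercLowPointHalfSpace`. By `percolationContinuityZ3_of_summable_twoArmOverlap`
(`PercLowPointHalfSpaceAssemblyRootAvoiding.lean`), `θ(p_c(ℤ³)) = 0` follows from the finiteness of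
`Σ_v P_{p_c}(G(v))`, where for `v ∈ ℍ₊ = {1 ≤ x₀}` the event `G(v)` says: the root edge `s(0,e₀)`
is open, `v` lies in the bush `β_v = C_{ℍ₊}(v) ∋ e₀` rooted at the origin, and the root `0` is
joined, by an open path of `ℍ = {0 ≤ x₀}` using no vertex of `β_v`, to a point at sup-distance
`≥ ‖v‖_∞`. This file performs the one remaining piece of bookkeeping — the dyadic shell
decomposition — against a hypothesis written in the route's own idiom (finite box sums, `.real`
probabilities, a power of `r`):

* `percolationContinuityZ3_of_shellTwoArmOverlapDecay` — **shell criterion**: if for some `δ > 0`,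
  `C` and all `r ≥ 1`
  `Σ_{v ∈ box(2r)} P_{p_c}((∃ i, r ≤ |vᵢ|) ∧ 1 ≤ v₀ ∧ s(0,e₀) open ∧ v ↔ e₀ in ℍ₊ ∧
      ∃ y, (∃ i, r ≤ |yᵢ|) ∧ 0 ↔ y in ℍ ∖ β_v) ≤ C r^{-δ}`
  — "the expected number of vertices of the bush rooted at the origin in the shell
  `r ≤ ‖v‖_∞ ≤ 2r`, on the event that the root's bush-avoiding cluster reaches sup-distance `r`,
  decays like a power of `r`" — then `PercolationContinuityZ3`;
  `assembly_of_shellTwoArmOverlapDecay` — hence the route decl `Assembly`.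
  Proof: every `v ∈ ℍ₊` lies in the dyadic shell `2^k ≤ ‖v‖_∞ < 2^{k+1}`, `k = log₂ ‖v‖_∞`, and
  `G(v)` is contained in the shell event at `r = 2^k`; summing the hypothesis over `k` gives a
  convergent geometric series `Σ_k C 2^{-kδ}`.

Heuristically the shell sum is `r^{m - a₂}` (`m` = mass exponent of tall wall-rooted bushes,
`a₂` = exponent of the two-arm event "bush to distance `r` AND a root-avoiding arm to distance
`r`"; numerically `m = d_f ≈ 2.52`, `a₂ ≈ 3.0`), so the hypothesis is the exponent inequality
`a₂ > m` of the route's bookkeeping, stated as ONE estimate (the cruxes A = `BoundaryTwoArmDecay`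
and B = `TallClusterMassBound` are its two marginals, which do not recombine: B conditions on ONE
arm, A measures disjoint clusters of `0` and `e₁` rather than a bush and an arm from its own root).

Sources: G. Grimmett, *Percolation* (1999), Thm. (7.35); elementary real analysis.
-/

noncomputable section

namespace Summit.CriticalPhenomena.PercolationContinuityZ3.Theorems

open MeasureTheory Filter Topology
open Literature.Probability.Percolation Literature.Probability.LatticeModels
open scoped ENNReal

namespace LowPoint

/-! ## Dyadic localisation of a lattice point -/

/-- Every `v ∈ ℤ³` with `v₀ ≥ 1` lies in a dyadic shell: for `k = log₂ ‖v‖_∞`,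
`v ∈ box(2^{k+1})` and `2^k ≤ |vᵢ|` for some coordinate `i`. [folklore] -/
theorem exists_dyadic_shell (v : Site 3) (hv : 1 ≤ v 0) :
    ∃ k : ℕ, v ∈ box 3 (2 ^ (k + 1)) ∧ ∃ i : Fin 3, ((2 ^ k : ℕ) : ℤ) ≤ |v i| := by
  obtain ⟨i₀, -, hi₀⟩ := Finset.exists_mem_eq_sup (Finset.univ : Finset (Fin 3))
    ⟨0, Finset.mem_univ _⟩ (fun i : Fin 3 => (v i).natAbs)
  have hle : ∀ i : Fin 3, (v i).natAbs ≤ (v i₀).natAbs := fun i => by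
    rw [← hi₀]
    exact Finset.le_sup (f := fun i : Fin 3 => (v i).natAbs) (Finset.mem_univ i)
  set N : ℕ := (v i₀).natAbs with hN
  have hN0 : N ≠ 0 := by
    have h0 := hle 0
    omega
  refine ⟨Nat.log 2 N, ?_, i₀, ?_⟩
  · rw [mem_box]
    intro i
    have h1 : (v i).natAbs < 2 ^ (Nat.log 2 N + 1) :=
      lt_of_le_of_lt (hle i) (Nat.lt_pow_succ_log_self (by norm_num) N)
    have h2 : ((v i).natAbs : ℤ) < ((2 ^ (Nat.log 2 N + 1) : ℕ) : ℤ) := by exact_mod_cast h1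
    rw [Int.natCast_natAbs] at h2
    push_cast at h2 ⊢
    constructor
    · linarith [neg_abs_le (v i)]
    · linarith [le_abs_self (v i)]
  · have h1 : 2 ^ Nat.log 2 N ≤ N := Nat.pow_log_le_self 2 hN0
    have h2 : ((2 ^ Nat.log 2 N : ℕ) : ℤ) ≤ ((N : ℕ) : ℤ) := by exact_mod_cast h1
    rw [hN, Int.natCast_natAbs] at h2
    exact h2

end LowPoint

open LowPoint

/-- **Shell criterion for `θ(p_c(ℤ³)) = 0`.** Suppose that for some `δ > 0` and `C`, for all
`r ≥ 1`,
`Σ_{v ∈ box(2r)} P_{p_c}((∃ i, r ≤ |vᵢ|) ∧ 1 ≤ v₀ ∧ s(0,e₀) open ∧ v ↔ e₀ in ℍ₊ ∧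
  ∃ y, (∃ i, r ≤ |yᵢ|) ∧ 0 ↔ y in ℍ ∖ C_{ℍ₊}(v)) ≤ C r^{-δ}`
(the expected number of vertices of the bush rooted at the origin in the shell `[r, 2r]`, on the
event that the root's bush-avoiding cluster reaches sup-distance `r`, decays like `r^{-δ}`). Then
`PercolationContinuityZ3`: the two-arm overlap of `percolationContinuityZ3_of_summable_twoArmOverlap`
is bounded by the convergent dyadic series `Σ_k C 2^{-kδ}`. [folklore] -/
theorem percolationContinuityZ3_of_shellTwoArmOverlapDecay
    (h : ∃ δ C : ℝ, 0 < δ ∧ ∀ r : ℕ, 1 ≤ r →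
      ∑ v ∈ box 3 (2 * r), (bondPercolation (zdGraph 3) (criticalProbI 3)).real
        {ω | (∃ i : Fin 3, (r : ℤ) ≤ |v i|) ∧ 1 ≤ v 0 ∧ s((0 : Site 3), Pi.single 0 1) ∈ ω ∧
          ω ∈ openConnIn {x : Site 3 | 1 ≤ x 0} v (Pi.single 0 1) ∧
            ∃ y : Site 3, (∃ i : Fin 3, (r : ℤ) ≤ |y i|) ∧
              ω ∈ openConnIn ({x : Site 3 | 0 ≤ x 0} \
                {x | ω ∈ openConnIn {x : Site 3 | 1 ≤ x 0} v x}) 0 y} ≤ C * (r : ℝ) ^ (-δ)) :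
    _root_.PercolationContinuityZ3 := by
  obtain ⟨δ, C, hδ, hC⟩ := h
  set μ := bondPercolation (zdGraph 3) (criticalProbI 3) with hμ
  -- the summand of the two-arm overlap, and the shell events at radius `r`
  set g : Site 3 → ℝ≥0∞ := fun v => μ
    {ω | 1 ≤ v 0 ∧ s((0 : Site 3), Pi.single 0 1) ∈ ω ∧
      ω ∈ openConnIn {x : Site 3 | 1 ≤ x 0} v (Pi.single 0 1) ∧
        ∃ y : Site 3, (∀ j : Fin 3, ∃ i : Fin 3, |v j| ≤ |y i|) ∧
          ω ∈ openConnIn ({x : Site 3 | 0 ≤ x 0} \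
            {x | ω ∈ openConnIn {x : Site 3 | 1 ≤ x 0} v x}) 0 y} with hg
  set sh : ℕ → Site 3 → ℝ≥0∞ := fun r v => μ
    {ω | (∃ i : Fin 3, (r : ℤ) ≤ |v i|) ∧ 1 ≤ v 0 ∧ s((0 : Site 3), Pi.single 0 1) ∈ ω ∧
      ω ∈ openConnIn {x : Site 3 | 1 ≤ x 0} v (Pi.single 0 1) ∧
        ∃ y : Site 3, (∃ i : Fin 3, (r : ℤ) ≤ |y i|) ∧
          ω ∈ openConnIn ({x : Site 3 | 0 ≤ x 0} \
            {x | ω ∈ openConnIn {x : Site 3 | 1 ≤ x 0} v x}) 0 y} with hsh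
  refine percolationContinuityZ3_of_summable_twoArmOverlap (ne_top_of_le_ne_top ?_
    (?_ : ∑' v : Site 3, g v ≤ ∑' k : ℕ, ∑' v : Site 3,
      if v ∈ box 3 (2 ^ (k + 1)) then sh (2 ^ k) v else 0))
  · -- the dyadic series converges
    -- WLOG `C ≥ 0`
    set C₁ : ℝ := max C 0 with hC₁
    have hC₁0 : 0 ≤ C₁ := le_max_right _ _
    set ρ : ℝ := (2 : ℝ) ^ (-δ) with hρ
    have hρ0 : 0 ≤ ρ := Real.rpow_nonneg (by norm_num) _
    have hρ1 : ρ < 1 := Real.rpow_lt_one_of_one_lt_of_neg (by norm_num) (by linarith)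
    have hshell : ∀ k : ℕ, ∑' v : Site 3, (if v ∈ box 3 (2 ^ (k + 1)) then sh (2 ^ k) v else 0) ≤
        ENNReal.ofReal C₁ * ENNReal.ofReal ρ ^ k := by
      intro k
      rw [tsum_eq_sum (s := box 3 (2 ^ (k + 1))) fun v hv => if_neg hv,
        Finset.sum_congr rfl fun v hv => if_pos hv]
      have hk : (1 : ℕ) ≤ 2 ^ k := Nat.one_le_two_pow
      have h1 := (hC (2 ^ k) hk).trans
        (mul_le_mul_of_nonneg_right (le_max_left C 0) (Real.rpow_nonneg (by positivity) _))
      have hpow : (((2 ^ k : ℕ) : ℝ)) ^ (-δ) = ρ ^ k := by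
        have e0 : (((2 ^ k : ℕ) : ℝ)) = (2 : ℝ) ^ (k : ℝ) := by
          push_cast
          exact (Real.rpow_natCast 2 k).symm
        rw [e0, ← Real.rpow_mul (by norm_num : (0 : ℝ) ≤ 2), hρ,
          ← Real.rpow_mul_natCast (by norm_num : (0 : ℝ) ≤ 2), mul_comm]
      rw [show 2 * 2 ^ k = 2 ^ (k + 1) by ring, hpow] at h1
      calc ∑ v ∈ box 3 (2 ^ (k + 1)), sh (2 ^ k) v
          = ENNReal.ofReal (∑ v ∈ box 3 (2 ^ (k + 1)), (sh (2 ^ k) v).toReal) := by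
            rw [ENNReal.ofReal_sum_of_nonneg fun v _ => ENNReal.toReal_nonneg]
            exact Finset.sum_congr rfl fun v _ =>
              (ENNReal.ofReal_toReal (measure_ne_top _ _)).symm
        _ ≤ ENNReal.ofReal (C₁ * ρ ^ k) := ENNReal.ofReal_le_ofReal h1
        _ = ENNReal.ofReal C₁ * ENNReal.ofReal ρ ^ k := by
            rw [ENNReal.ofReal_mul hC₁0, ENNReal.ofReal_pow hρ0]
    have hle : ∑' k : ℕ, ∑' v : Site 3, (if v ∈ box 3 (2 ^ (k + 1)) then sh (2 ^ k) v else 0) ≤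
        ENNReal.ofReal C₁ * (1 - ENNReal.ofReal ρ)⁻¹ := by
      calc ∑' k : ℕ, ∑' v : Site 3, (if v ∈ box 3 (2 ^ (k + 1)) then sh (2 ^ k) v else 0)
          ≤ ∑' k : ℕ, ENNReal.ofReal C₁ * ENNReal.ofReal ρ ^ k := ENNReal.tsum_le_tsum hshell
        _ = ENNReal.ofReal C₁ * (1 - ENNReal.ofReal ρ)⁻¹ := by
            rw [ENNReal.tsum_mul_left, ENNReal.tsum_geometric]
    refine ne_top_of_le_ne_top ?_ hle
    refine ENNReal.mul_ne_top ENNReal.ofReal_ne_top (ENNReal.inv_ne_top.2 ?_)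
    exact (tsub_pos_of_lt ((ENNReal.ofReal_lt_one).2 hρ1)).ne'
  · -- pointwise domination by the dyadic shells, then Fubini for series
    calc ∑' v : Site 3, g v
        ≤ ∑' v : Site 3, ∑' k : ℕ, (if v ∈ box 3 (2 ^ (k + 1)) then sh (2 ^ k) v else 0) := by
          refine ENNReal.tsum_le_tsum fun v => ?_
          by_cases hv : 1 ≤ v 0
          · obtain ⟨k, hbox, i₀, hi₀⟩ := exists_dyadic_shell v hv
            refine le_trans ?_ (ENNReal.le_tsum k)
            rw [if_pos hbox]
            refine measure_mono fun ω hω => ?_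
            rw [Set.mem_setOf_eq] at hω ⊢
            obtain ⟨hv0, hroot, hbush, y, hy, havoid⟩ := hω
            obtain ⟨i₁, hi₁⟩ := hy i₀
            exact ⟨⟨i₀, hi₀⟩, hv0, hroot, hbush, y, ⟨i₁, hi₀.trans hi₁⟩, havoid⟩
          · have hempty : {ω : BondConfig (Site 3) | 1 ≤ v 0 ∧ s((0 : Site 3), Pi.single 0 1) ∈ ω ∧
                ω ∈ openConnIn {x : Site 3 | 1 ≤ x 0} v (Pi.single 0 1) ∧
                  ∃ y : Site 3, (∀ j : Fin 3, ∃ i : Fin 3, |v j| ≤ |y i|) ∧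
                    ω ∈ openConnIn ({x : Site 3 | 0 ≤ x 0} \
                      {x | ω ∈ openConnIn {x : Site 3 | 1 ≤ x 0} v x}) 0 y} = ∅ :=
              Set.eq_empty_of_forall_notMem fun ω hω => hv hω.1
            simp only [hg, hempty, measure_empty]
            exact zero_le
      _ = ∑' k : ℕ, ∑' v : Site 3, (if v ∈ box 3 (2 ^ (k + 1)) then sh (2 ^ k) v else 0) :=
          ENNReal.tsum_comm

/-- **`Assembly` from the shell criterion** (A, B, C are not used; the shell estimate is the
exponent inequality `a₂ > m` of the route's bookkeeping stated as one hypothesis). [folklore] -/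
theorem assembly_of_shellTwoArmOverlapDecay
    (h : ∃ δ C : ℝ, 0 < δ ∧ ∀ r : ℕ, 1 ≤ r →
      ∑ v ∈ box 3 (2 * r), (bondPercolation (zdGraph 3) (criticalProbI 3)).real
        {ω | (∃ i : Fin 3, (r : ℤ) ≤ |v i|) ∧ 1 ≤ v 0 ∧ s((0 : Site 3), Pi.single 0 1) ∈ ω ∧
          ω ∈ openConnIn {x : Site 3 | 1 ≤ x 0} v (Pi.single 0 1) ∧
            ∃ y : Site 3, (∃ i : Fin 3, (r : ℤ) ≤ |y i|) ∧
              ω ∈ openConnIn ({x : Site 3 | 0 ≤ x 0} \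
                {x | ω ∈ openConnIn {x : Site 3 | 1 ≤ x 0} v x}) 0 y} ≤ C * (r : ℝ) ^ (-δ)) :
    Theses.PercLowPointHalfSpace.Assembly :=
  fun _ _ _ => percolationContinuityZ3_of_shellTwoArmOverlapDecay h

end Summit.CriticalPhenomena.PercolationContinuityZ3.Theorems

end
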